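import Summits.MatrixMultiplication.MatrixMultiplication.Theorems.FarEdgeDescentGenericDomination
import Summits.MatrixMultiplication.MatrixMultiplication.Theorems.FarEdgeDescentStratumSymmetries
import Literature.Computability.AlgebraicComplexity.AsymptoticRankAlgebraicExtension
import Mathlib.FieldTheory.IsAlgClosed.Classification
import Mathlib.NumberTheory.Transcendental.Liouville.LiouvilleNumber
import HarnessLib

/-!
# Galois genericity on the BCZ line: every transcendental modulus is a generic member

Route `FarEdgeDescent` (cell `decomp-mm`, lens 2 «structural dichotomy (special vs generic)»,
gen 38), Kernel XIII; support for the aside `SubLogRate` (stmt-MatrixMultiplication-25371).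

Kernel IX-b (`FarEdgeDescentGenericDomination`) made the special/generic split of the line
`q ↦ 𝔖(q) = fam ℂ q` (the BCZ normal forms of the same-support stratum of `⟨2,2,2⟩ ≅ 𝔖(1)`) a
theorem in the CHNVZ form: a DOMINANT modulus `q₀` exists (`R̃(𝔖(q)) ≤ R̃(𝔖(q₀))` for all `q`),
the non-dominant (special) moduli are countably many, and `2^ω = R̃(𝔖(1)) ≤ R̃(𝔖(q₀))`.  That
existence statement is ineffective: it names no generic member.  This file NAMES them, by the
arithmetic of the modulus:

* §1 (any fields): the asymptotic rank is invariant under field isomorphisms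
  (`asymptoticRank_map_ringEquiv`, from the tree's `asymptoticRank_map_le` both ways), and a
  field isomorphism acts on the line through the modulus, `σ ∘ 𝔖(q) = 𝔖(σ q)` (`map_fam`); hence
  every sublevel set `{q | R̃(𝔖(q)) ≤ r}` of the line over `ℂ` is `Aut(ℂ)`-stable
  (`le_level_map_iff`), as it is inversion-stable (Kernel IX-c, `le_level_inv_iff`) and
  conjugation-stable (`asymptoticRank_fam_conj`).
* §2: `Aut(ℂ)` acts TRANSITIVELY on the transcendental numbers (`exists_ringEquiv_apply_eq`:
  Steinitz' transcendence-basis argument, here assembled from Mathlib's classification of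
  algebraically closed fields — two transcendence bases of `ℂ/ℤ` through `a` resp. `b`, an
  equipotence matching `a` with `b`, `IsAlgClosure.equivOfEquiv`).
* §3, the lens reading: **every transcendental modulus is dominant**
  (`dominant_of_transcendental`): the sublevel set at the level `R̃(𝔖(q₀))`, `q₀` transcendental,
  contains the whole `Aut(ℂ)`-orbit of `q₀`, i.e. all transcendentals, an infinite set, so it is
  all of `ℂ` by the sublevel dichotomy `flatLocus_eq_univ_or_finite` (CHNVZ Thm. 1.2 on the line).
  Consequences: **the special moduli are algebraic numbers** (`isAlgebraic_of_lt`: `R̃(𝔖(q)) <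
  R̃(𝔖(q₁))` for some `q₁` forces `q ∈ ℚ̄`), sharpening «countable» to «`⊆ ℚ̄`»; all transcendental
  members share ONE value `r_gen` (`asymptoticRank_fam_eq_of_transcendental`), the maximum of `R̃`
  on the line (`asymptoticRank_fam_eq_of_dominant_of_transcendental`); **`2^ω ≤ R̃(𝔖(q))` and
  `R̃(𝔖(q)) ≤ 2^τ ⟹ ω ≤ τ` for EVERY transcendental `q`**
  (`rpow_omega_le_asymptoticRank_fam_of_transcendental`, `omega_le_of_transcendental`) — e.g. for
  the Liouville modulus `q = Σ 10^{-k!}` (`rpow_omega_le_asymptoticRank_fam_liouville`); and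
  flatness of ONE transcendental member is flatness of the whole line, hence `ω = 2`
  (`line_flat_iff_of_transcendental`, `summit_of_transcendental_flat`).
* What is NOT proved: the converse `ω = 2 ⟹ R̃(𝔖(q)) = 4` for transcendental `q` (necessity of
  generic flatness = Strassen's asymptotic rank conjecture on this stratum), and whether any
  algebraic `q ∉ {0}` is special at all.  Nothing here bounds `ω` numerically.

References: M. Christandl, K. Hoeberechts, H. Nieuwboer, P. Vrana, J. Zuiddam, *Asymptotic tensor
rank is characterized by polynomials*, arXiv:2411.15789, Thm. 1.2
[ChristandlHoeberechtsNieuwboerVranaZuiddam2025]; P. Bürgisser, M. Clausen, M. A. Shokrollahi,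
*Algebraic Complexity Theory*, §15.3 (15.14) (base change along field homomorphisms)
[BurgisserClausenShokrollahi1997]; M. Bläser, M. Christandl, J. Zuiddam, arXiv:1705.09652, §2
[BlaserChristandlZuiddam2017]; E. Steinitz, *Algebraische Theorie der Körper* (1910), §24
(transcendence bases; automorphisms of algebraically closed fields) — folklore, as formalised in
Mathlib's `IsAlgClosed.equivOfTranscendenceBasis`.
-/

noncomputable section

open scoped BigOperators Cardinal

set_option linter.dupNamespace false

namespace Summit.MatrixMultiplication.MatrixMultiplication.Theorems.FarEdgeDescentGaloisGeneric

open Literature.Computability.AlgebraicComplexity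
open Summit.MatrixMultiplication.MatrixMultiplication.Theorems.FarEdgeDescentSignTwist
open Summit.MatrixMultiplication.MatrixMultiplication.Theorems.FarEdgeDescentSignTwistDet
open Summit.MatrixMultiplication.MatrixMultiplication.Theorems.FarEdgeDescentWeightFamily
open Summit.MatrixMultiplication.MatrixMultiplication.Theorems.FarEdgeDescentSupportStratumDoor
open Summit.MatrixMultiplication.MatrixMultiplication.Theorems.FarEdgeDescentGenericDomination
open Summit.MatrixMultiplication.MatrixMultiplication.Theorems.FarEdgeDescentStratumSymmetries

/-! ## 1. Field isomorphisms act on the line through the modulus -/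

section RingEquiv

variable {K L : Type} [Field K] [Field L]

/-- **The asymptotic rank is invariant under field isomorphisms**: `R̃_L(σ ∘ t) = R̃_K(t)` for
`σ : K ≃+* L` (base change along `σ` and along `σ⁻¹`).
[cite: BurgisserClausenShokrollahi1997, §15.3 (15.14)] -/
theorem asymptoticRank_map_ringEquiv {ι κ μ : Type} [Fintype ι] [Fintype κ] [Fintype μ]
    (σ : K ≃+* L) (t : ι → κ → μ → K) :
    asymptoticRank (fun a b c => σ (t a b c)) = asymptoticRank t := by
  refine le_antisymm (asymptoticRank_map_le (σ : K →+* L) t) ?_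
  simpa using asymptoticRank_map_le (σ.symm : L →+* K) (fun a b c => σ (t a b c))

/-- **A field homomorphism acts on the line through the modulus: `f ∘ 𝔖(q) = 𝔖(f q)`** (the
entries of `𝔖(q)` are `0`, `1` and `q`). [cite: BlaserChristandlZuiddam2017, §2] -/
theorem map_fam (f : K →+* L) (q : K) : (fun a x c => f (fam K q a x c)) = fam L (f q) := by
  funext a x c
  simp only [fam_apply, wS, famW]
  split_ifs <;> simp

/-- **`R̃(𝔖(σ q)) = R̃(𝔖(q))` for every field isomorphism `σ`.**
[cite: BurgisserClausenShokrollahi1997, §15.3 (15.14)] -/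
theorem asymptoticRank_fam_map (σ : K ≃+* L) (q : K) :
    asymptoticRank (fam L (σ q)) = asymptoticRank (fam K q) := by
  have h : (fun a x c => σ (fam K q a x c)) = fam L (σ q) := by
    simpa only [RingHom.coe_coe] using map_fam (σ : K →+* L) q
  rw [← h]
  exact asymptoticRank_map_ringEquiv σ (fam K q)

end RingEquiv

/-- **The sublevel sets of the line are `Aut(ℂ)`-stable**: `R̃(𝔖(σ q)) ≤ r ⟺ R̃(𝔖(q)) ≤ r`.
[cite: ChristandlHoeberechtsNieuwboerVranaZuiddam2025, Theorem 1.2] -/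
theorem le_level_map_iff (σ : ℂ ≃+* ℂ) (q : ℂ) (r : ℝ) :
    asymptoticRank (fam ℂ (σ q)) ≤ r ↔ asymptoticRank (fam ℂ q) ≤ r := by
  rw [asymptoticRank_fam_map]

/-- **The special set below any value is `Aut(ℂ)`-stable**:
`R̃(𝔖(σ q)) < R̃(𝔖(q₀)) ⟺ R̃(𝔖(q)) < R̃(𝔖(q₀))`.
[cite: ChristandlHoeberechtsNieuwboerVranaZuiddam2025, Theorem 1.2] -/
theorem lt_level_map_iff (σ : ℂ ≃+* ℂ) (q q₀ : ℂ) :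
    asymptoticRank (fam ℂ (σ q)) < asymptoticRank (fam ℂ q₀) ↔
      asymptoticRank (fam ℂ q) < asymptoticRank (fam ℂ q₀) := by
  rw [asymptoticRank_fam_map]

/-- **Conjugate moduli give the same value: `R̃(𝔖(q̄)) = R̃(𝔖(q))`** (with Kernel IX-c's
`R̃(𝔖(q⁻¹)) = R̃(𝔖(q))`: on the unit circle `R̃(𝔖(q)) = R̃(𝔖(q⁻¹)) = R̃(𝔖(q̄))` trivially).
[cite: BurgisserClausenShokrollahi1997, §15.3 (15.14)] -/
theorem asymptoticRank_fam_conj (q : ℂ) :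
    asymptoticRank (fam ℂ (starRingEnd ℂ q)) = asymptoticRank (fam ℂ q) := by
  have h := asymptoticRank_fam_map Complex.conjAe.toRingEquiv q
  simpa using h

/-! ## 2. `Aut(ℂ)` is transitive on the transcendental numbers -/

section Transitive

open Cardinal IsAlgClosed

/-- A transcendental number is an algebraically independent singleton. [folklore] -/
theorem algebraicIndepOn_singleton {a : ℂ} (ha : Transcendental ℤ a) :
    AlgebraicIndepOn ℤ id ({a} : Set ℂ) :=
  (algebraicIndependent_singleton_iff (⟨a, rfl⟩ : ({a} : Set ℂ))).2 ha

/-- `ℂ` is uncountable, as a cardinal inequality. [folklore] -/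
theorem aleph0_lt_mk_complex : ℵ₀ < #ℂ := by
  rw [Cardinal.mk_complex]
  exact Cardinal.aleph0_lt_continuum

/-- A transcendence basis of `ℂ/ℤ` is equipotent with `ℂ`. [folklore] -/
theorem mk_eq_of_isTranscendenceBasis {s : Set ℂ} (hs : IsTranscendenceBasis ℤ ((↑) : s → ℂ)) :
    #s = #ℂ :=
  (cardinal_eq_cardinal_transcendence_basis_of_aleph0_lt' _ hs (le_of_eq mk_int)
    aleph0_lt_mk_complex).symm

/-- **`Aut(ℂ)` is transitive on transcendental numbers**: for transcendental `a`, `b` there is a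
field automorphism `σ` of `ℂ` with `σ a = b` (Steinitz: transcendence bases `s ∋ a`, `t ∋ b` of
`ℂ`, an equipotence `s ≃ t` matching `a` with `b`, extended through `ℤ[s] ≃ ℤ[t]` to the
algebraic closures `ℂ = ℤ[s]^alg ≃ ℤ[t]^alg = ℂ`). [folklore] -/
theorem exists_ringEquiv_apply_eq {a b : ℂ} (ha : Transcendental ℤ a) (hb : Transcendental ℤ b) :
    ∃ σ : ℂ ≃+* ℂ, σ a = b := by
  classical
  obtain ⟨s, has, hs⟩ := exists_isTranscendenceBasis_superset (algebraicIndepOn_singleton ha)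
  obtain ⟨t, hbt, ht⟩ := exists_isTranscendenceBasis_superset (algebraicIndepOn_singleton hb)
  have hsa : a ∈ s := has rfl
  have htb : b ∈ t := hbt rfl
  obtain ⟨e₀⟩ := Cardinal.eq.1
    ((mk_eq_of_isTranscendenceBasis hs).trans (mk_eq_of_isTranscendenceBasis ht).symm)
  -- an equipotence of the two bases matching `a` with `b`
  let e : s ≃ t := e₀.trans (Equiv.swap (e₀ ⟨a, hsa⟩) ⟨b, htb⟩)
  have hea : e ⟨a, hsa⟩ = ⟨b, htb⟩ := by simp [e]
  letI := isAlgClosure_of_transcendence_basis ((↑) : s → ℂ) hs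
  letI := isAlgClosure_of_transcendence_basis ((↑) : t → ℂ) ht
  -- `ℤ[s] ≃ ℤ[X_s] ≃ ℤ[X_t] ≃ ℤ[t]`
  let φ : Algebra.adjoin ℤ (Set.range ((↑) : s → ℂ)) ≃+*
      Algebra.adjoin ℤ (Set.range ((↑) : t → ℂ)) :=
    hs.1.aevalEquiv.symm.toRingEquiv.trans
      ((MvPolynomial.renameEquiv ℤ e).toRingEquiv.trans ht.1.aevalEquiv.toRingEquiv)
  have haS : a ∈ Algebra.adjoin ℤ (Set.range ((↑) : s → ℂ)) :=
    Algebra.subset_adjoin ⟨⟨a, hsa⟩, rfl⟩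
  have h1 : hs.1.aevalEquiv.symm ⟨a, haS⟩ = MvPolynomial.X ⟨a, hsa⟩ := by
    rw [AlgEquiv.symm_apply_eq]
    exact Subtype.ext (by simp)
  have h2 : φ ⟨a, haS⟩ = ht.1.aevalEquiv (MvPolynomial.X ⟨b, htb⟩) := by
    simp only [φ, RingEquiv.trans_apply, AlgEquiv.coe_ringEquiv, h1,
      MvPolynomial.renameEquiv_apply, MvPolynomial.rename_X, hea]
  refine ⟨IsAlgClosure.equivOfEquiv ℂ ℂ φ, ?_⟩
  calc IsAlgClosure.equivOfEquiv ℂ ℂ φ a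
      = IsAlgClosure.equivOfEquiv ℂ ℂ φ
          (algebraMap (Algebra.adjoin ℤ (Set.range ((↑) : s → ℂ))) ℂ ⟨a, haS⟩) := rfl
    _ = algebraMap (Algebra.adjoin ℤ (Set.range ((↑) : t → ℂ))) ℂ (φ ⟨a, haS⟩) :=
        IsAlgClosure.equivOfEquiv_algebraMap ℂ ℂ φ _
    _ = b := by rw [h2, ht.1.algebraMap_aevalEquiv, MvPolynomial.aeval_X]

/-- The transcendental numbers form an infinite set (a transcendence basis of `ℂ/ℤ` consists of
transcendentals and is equipotent with `ℂ`). [folklore] -/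
theorem infinite_transcendental : {q : ℂ | Transcendental ℤ q}.Infinite := by
  obtain ⟨s, hs⟩ := exists_isTranscendenceBasis ℤ ℂ
  have hinf : s.Infinite := Set.infinite_coe_iff.1 (Cardinal.infinite_iff.2
    (by rw [mk_eq_of_isTranscendenceBasis hs]; exact aleph0_lt_mk_complex.le))
  exact hinf.mono fun q hq => hs.1.transcendental ⟨q, hq⟩

end Transitive

/-! ## 3. Every transcendental modulus is a generic member of the stratum -/

section Generic

/-- **All transcendental members have the same asymptotic rank.**
[cite: BurgisserClausenShokrollahi1997, §15.3 (15.14)] -/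
theorem asymptoticRank_fam_eq_of_transcendental {a b : ℂ} (ha : Transcendental ℤ a)
    (hb : Transcendental ℤ b) : asymptoticRank (fam ℂ a) = asymptoticRank (fam ℂ b) := by
  obtain ⟨σ, rfl⟩ := exists_ringEquiv_apply_eq ha hb
  exact (asymptoticRank_fam_map σ a).symm

/-- **Every transcendental modulus is dominant: `R̃(𝔖(q)) ≤ R̃(𝔖(q₀))` for all `q`, `q₀ ∉ ℚ̄`.**
The sublevel set at level `R̃(𝔖(q₀))` contains every transcendental (one `Aut(ℂ)`-orbit), an
infinite set, hence is all of `ℂ` by the sublevel dichotomy on the line.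
[cite: ChristandlHoeberechtsNieuwboerVranaZuiddam2025, Theorem 1.2] -/
theorem dominant_of_transcendental {q₀ : ℂ} (hq₀ : Transcendental ℤ q₀) (q : ℂ) :
    asymptoticRank (fam ℂ q) ≤ asymptoticRank (fam ℂ q₀) := by
  have hsub : {q : ℂ | Transcendental ℤ q} ⊆
      {q : ℂ | asymptoticRank (fam ℂ q) ≤ asymptoticRank (fam ℂ q₀)} :=
    fun q hq => (asymptoticRank_fam_eq_of_transcendental hq hq₀).le
  have huniv := (flatLocus_eq_univ_or_finite (asymptoticRank (fam ℂ q₀))).resolve_right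
    fun hfin => infinite_transcendental (hfin.subset hsub)
  exact (show q ∈ {q : ℂ | asymptoticRank (fam ℂ q) ≤ asymptoticRank (fam ℂ q₀)} from
    huniv ▸ Set.mem_univ q)

/-- **The special members are algebraic numbers**: if `R̃(𝔖(q)) < R̃(𝔖(q₁))` for some `q₁`
(e.g. `q` non-dominant), then `q ∈ ℚ̄` — CHNVZ's «countably many special parameters» sharpened
to «algebraic parameters» on this line.
[cite: ChristandlHoeberechtsNieuwboerVranaZuiddam2025, Theorem 1.2] -/
theorem isAlgebraic_of_lt {q q₁ : ℂ} (h : asymptoticRank (fam ℂ q) < asymptoticRank (fam ℂ q₁)) :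
    IsAlgebraic ℤ q := by
  by_contra hq
  exact absurd h (not_lt.2 (dominant_of_transcendental hq q₁))

/-- The special set below any value lies inside `ℚ̄`.
[cite: ChristandlHoeberechtsNieuwboerVranaZuiddam2025, Theorem 1.2] -/
theorem special_subset_algebraic (q₀ : ℂ) :
    {q : ℂ | asymptoticRank (fam ℂ q) < asymptoticRank (fam ℂ q₀)} ⊆
      {q : ℂ | IsAlgebraic ℤ q} :=
  fun _ hq => isAlgebraic_of_lt hq

/-- **The generic value is attained at every transcendental modulus**: for any dominant `q₀`
(`exists_dominant_fam`) and transcendental `q`, `R̃(𝔖(q)) = R̃(𝔖(q₀)) = r_gen`.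
[cite: ChristandlHoeberechtsNieuwboerVranaZuiddam2025, Corollary 4.4] -/
theorem asymptoticRank_fam_eq_of_dominant_of_transcendental {q₀ : ℂ}
    (hq₀ : ∀ q, asymptoticRank (fam ℂ q) ≤ asymptoticRank (fam ℂ q₀)) {q : ℂ}
    (hq : Transcendental ℤ q) : asymptoticRank (fam ℂ q) = asymptoticRank (fam ℂ q₀) :=
  le_antisymm (hq₀ q) (dominant_of_transcendental hq q₀)

/-- **`2^ω = R̃(⟨2,2,2⟩) ≤ R̃(𝔖(q))` for every transcendental modulus `q`**: a NAMED generic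
member of the stratum dominates the special point `𝔖(1) ≅ ⟨2,2,2⟩`.
[cite: ChristandlHoeberechtsNieuwboerVranaZuiddam2025, §1.2 (remark on cw₂)] -/
theorem rpow_omega_le_asymptoticRank_fam_of_transcendental {q : ℂ} (hq : Transcendental ℤ q) :
    (2 : ℝ) ^ omega ℂ ≤ asymptoticRank (fam ℂ q) :=
  rpow_omega_le_asymptoticRank_fam_of_dominant (dominant_of_transcendental hq)

/-- **`R̃(𝔖(q)) ≤ 2^τ ⟹ ω ≤ τ` for every transcendental modulus `q`** (the identity exponent
map, valid for the generic member, now at every named transcendental point).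
[cite: ChristandlHoeberechtsNieuwboerVranaZuiddam2025, Theorem 1.2] -/
theorem omega_le_of_transcendental {q : ℂ} (hq : Transcendental ℤ q) {τ : ℝ}
    (h : asymptoticRank (fam ℂ q) ≤ (2 : ℝ) ^ τ) : omega ℂ ≤ τ :=
  omega_le_of_dominant (dominant_of_transcendental hq) h

/-- **Flatness of one transcendental member is flatness of the whole line**:
`R̃(𝔖(q)) ≤ r ⟺ ∀ q', R̃(𝔖(q')) ≤ r` for `q` transcendental.
[cite: ChristandlHoeberechtsNieuwboerVranaZuiddam2025, Theorem 1.2] -/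
theorem line_flat_iff_of_transcendental {q : ℂ} (hq : Transcendental ℤ q) (r : ℝ) :
    asymptoticRank (fam ℂ q) ≤ r ↔ ∀ q', asymptoticRank (fam ℂ q') ≤ r :=
  ⟨fun h q' => (dominant_of_transcendental hq q').trans h, fun h => h q⟩

/-- **A flat transcendental member forces `ω = 2`** (indeed every member is then flat; one flat
member `q ≠ 0` suffices by the Cohn–Umans door). [cite: CohnUmans2013, Thm. 6] -/
theorem summit_of_transcendental_flat {q : ℂ} (hq : Transcendental ℤ q)
    (h : asymptoticRank (fam ℂ q) ≤ 4) : _root_.MatrixMultiplication :=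
  summit_of_asymptoticRank_fam_le_four one_ne_zero ((dominant_of_transcendental hq 1).trans h)

/-- **`ω > 2` read at a transcendental modulus**: `4 < R̃(𝔖(q))` strictly, with the excess
`2^ω ≤ R̃(𝔖(q))`. [cite: ConnerGesmundoLandsbergVenturaWang2020, Conj. 1.4] -/
theorem four_lt_of_not_summit_of_transcendental (hS : ¬ _root_.MatrixMultiplication) {q : ℂ}
    (hq : Transcendental ℤ q) :
    4 < asymptoticRank (fam ℂ q) ∧ (2 : ℝ) ^ omega ℂ ≤ asymptoticRank (fam ℂ q) :=
  four_lt_generic_of_not_summit hS (dominant_of_transcendental hq)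

/-- **The dichotomy, arithmetic form.** Either every member of the line is flat and `ω = 2`, or
the flat members are finitely many ALGEBRAIC numbers.
[cite: ChristandlHoeberechtsNieuwboerVranaZuiddam2025, Theorem 1.2] -/
theorem flat_dichotomy_algebraic :
    ((∀ q, asymptoticRank (fam ℂ q) ≤ 4) ∧ _root_.MatrixMultiplication) ∨
      ({q : ℂ | asymptoticRank (fam ℂ q) ≤ 4}.Finite ∧
        {q : ℂ | asymptoticRank (fam ℂ q) ≤ 4} ⊆ {q : ℂ | IsAlgebraic ℤ q}) := by
  obtain ⟨q₀, hq₀⟩ := infinite_transcendental.nonempty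
  rcases flat_dichotomy (dominant_of_transcendental hq₀) with ⟨-, hall, hS⟩ | ⟨hlt, hfin⟩
  · exact Or.inl ⟨hall, hS⟩
  · exact Or.inr ⟨hfin, fun q hq => isAlgebraic_of_lt (lt_of_le_of_lt hq hlt)⟩

/-! ### A named generic member: the Liouville modulus -/

/-- The Liouville number `Σ_k 10^{-k!}`, as a complex number, is transcendental. [folklore] -/
theorem transcendental_liouville : Transcendental ℤ ((liouvilleNumber 10 : ℝ) : ℂ) := by
  have h := (transcendental_algebraMap_iff (R := ℤ) (A := ℂ) (algebraMap ℝ ℂ).injective).2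
    (transcendental_liouvilleNumber (by norm_num : 2 ≤ (10 : ℕ)))
  simpa using h

/-- **`2^ω ≤ R̃(𝔖(Σ_k 10^{-k!}))`**: the Liouville modulus is a generic member of the same-support
stratum of `⟨2,2,2⟩`, and its asymptotic rank bounds `ω`:
`R̃(𝔖(Σ 10^{-k!})) ≤ 2^τ ⟹ ω ≤ τ`.
[cite: ChristandlHoeberechtsNieuwboerVranaZuiddam2025, §1.2 (remark on cw₂)] -/
theorem rpow_omega_le_asymptoticRank_fam_liouville :
    (2 : ℝ) ^ omega ℂ ≤ asymptoticRank (fam ℂ ((liouvilleNumber 10 : ℝ) : ℂ)) ∧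
      ∀ τ : ℝ, asymptoticRank (fam ℂ ((liouvilleNumber 10 : ℝ) : ℂ)) ≤ (2 : ℝ) ^ τ →
        omega ℂ ≤ τ :=
  ⟨rpow_omega_le_asymptoticRank_fam_of_transcendental transcendental_liouville,
    fun _ h => omega_le_of_transcendental transcendental_liouville h⟩

end Generic

end Summit.MatrixMultiplication.MatrixMultiplication.Theorems.FarEdgeDescentGaloisGeneric

end
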